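import Summits.NavierStokesRegularity.NavierStokesRegularity.Cruxes.TypeIConcentration.Disproof
import Literature.Analysis.FluidPDE.NSQuasipotential

/-!
# drefute checks for stub `stub_scaledEnergyBound` (line `bp-scaled-energy`, crux 2881)

Hypothesis-mutation theorems (Lean-certified) for the single registered stub, which is
support item stmt-NavierStokesRegularity-2884 `ScaledEnergyBound` verbatim.

* `scaledEnergyBound_false_without_posT` — dropping `0 < T` makes the stub FALSE: for `T ≤ 0`
  the classical interval `[0,T)` is empty and the Leray–Hopf package only sees `t ≥ 0`, so the
  slices `u t`, `t < T`, are unconstrained junk except for the pointwise rate; a field saturating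
  the rate (`u t x = (T−t)^{-1/2} e₁` for `t < T = −1`, rest state from `T` on) has scaled local
  energy `|B₁| r₀² (T−t)⁻¹ → ∞` at the fixed radius `r₀`. (For the crux itself `0 < T` is
  decoration — Disproof `typeIConcentration_iff_withoutPositivity` — because there `T ≤ 0` kills
  `¬HasSmoothExtensionPast`; for 2884 it is not.) Moral: the conclusion's `∀ᶠ t in 𝓝[<] T`
  quantifies over honest (classical) slices only because `0 < T`.
* Dropping `IsLerayHopfOn`: FALSE — already in the Disproof, `scaledEnergyBound_false_without_LerayHopf`
  (ODE blow-up `odeVel/odePres`).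
* Dropping `0 < ν`: harmless (`ν ≤ 0 ⇒ √ν = 0 ⇒` the rate forces `u ≡ 0` near `T`), see
  `scaledEnergy_trivial_of_nonpos_viscosity`.
-/

noncomputable section

set_option linter.dupNamespace false

namespace Summit.NavierStokesRegularity.NavierStokesRegularity.Cruxes.TypeIConcentration.Drefute

open Set Filter Topology MeasureTheory Metric Function
open Literature.Analysis.FluidPDE
open Summit.NavierStokesRegularity.NavierStokesRegularity.Cruxes.TypeIConcentration.Disproof
open scoped InnerProductSpace RealInnerProductSpace ENNReal

local notation "E3" => EuclideanSpace ℝ (Fin 3)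

/-! ## §1 `0 < T` is load-bearing for 2884 (pre-initial junk) -/

/-- Support item 2884 / the stub with the side condition `0 < T` DROPPED. -/
def ScaledEnergyBoundWithoutPosT : Prop :=
  ∀ C : ℝ, 0 < C → ∃ A : ℝ, ∀ (ν T : ℝ), 0 < ν →
    ∀ (u : ℝ → E3 → E3) (p : ℝ → E3 → ℝ),
      IsClassicalNSSolutionOn (Set.Ico 0 T) ν 0 u p → IsLerayHopfOn T ν 0 (u 0) u →
      HasRapidSpatialDecay (u 0) → RateNear C ν T u →
      ∃ r₀ : ℝ, 0 < r₀ ∧ ∀ᶠ t in 𝓝[<] T, ∀ x₀ : E3, ∀ r : ℝ, 0 < r → r ≤ r₀ →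
        r⁻¹ * (∫ x in Metric.ball x₀ r, ‖u t x‖ ^ 2) ≤ A * ν ^ 2

/-- Amplitude of the pre-initial junk: `b(t) = (−1−t)^{-1/2}`. -/
def junkAmp (t : ℝ) : ℝ := (Real.sqrt (-1 - t))⁻¹

/-- Pre-initial junk field: saturates the Type-I(1) rate before `T = −1`, rest state from `−1` on. -/
def preJunk : ℝ → E3 → E3 := fun t _ => if t < -1 then junkAmp t • e₁ else 0

theorem preJunk_of_lt {t : ℝ} (ht : t < -1) : preJunk t = fun _ => junkAmp t • e₁ := by
  funext x; simp [preJunk, ht]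

theorem preJunk_of_ge {t : ℝ} (ht : -1 ≤ t) : preJunk t = 0 := by
  funext x; simp [preJunk, not_lt.2 ht]

theorem preJunk_zero : preJunk 0 = 0 := preJunk_of_ge (by norm_num)

theorem junkAmp_pos {t : ℝ} (ht : t < -1) : 0 < junkAmp t :=
  inv_pos.2 (Real.sqrt_pos.2 (by linarith))

theorem junkAmp_sq {t : ℝ} (ht : t < -1) : junkAmp t ^ 2 = (-1 - t)⁻¹ := by
  rw [junkAmp, inv_pow, Real.sq_sqrt (by linarith)]

/-- With an empty classical interval every pair is a classical solution. -/
theorem isClassicalNSSolutionOn_of_nonpos {T : ℝ} (hT : T ≤ 0) (ν : ℝ) (u : ℝ → E3 → E3)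
    (p : ℝ → E3 → ℝ) : IsClassicalNSSolutionOn (Set.Ico 0 T) ν 0 u p := by
  have hI : Set.Ico (0:ℝ) T = ∅ := Set.Ico_eq_empty (not_lt.2 hT)
  rw [hI]
  exact
  { smooth_velocity := by intro q hq; simp at hq
    smooth_pressure := by intro q hq; simp at hq
    momentum := fun t ht => absurd ht (Set.notMem_empty t)
    divFree := fun t ht => absurd ht (Set.notMem_empty t) }

/-- The pre-initial junk field is "Leray–Hopf on `[0, −1)`": every clause of the package lives
at times `t ≥ 0 > −1`, where the field is the rest state. -/
theorem isLerayHopfOn_preJunk (ν : ℝ) : IsLerayHopfOn (-1) ν 0 (preJunk 0) preJunk := by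
  have hI : Set.Ioo (0:ℝ) (-1) = ∅ := Set.Ioo_eq_empty (by norm_num)
  have hIcc : ∀ t : ℝ, t ∉ Set.Icc (0:ℝ) (-1) := fun t ht => absurd (ht.1.trans ht.2) (by norm_num)
  have hev0 : ∀ᶠ t in 𝓝[>] (0:ℝ), preJunk t = preJunk 0 := by
    filter_upwards [self_mem_nhdsWithin] with t ht
    rw [preJunk_zero, preJunk_of_ge (by linarith [mem_Ioi.1 ht])]
  refine
  { weak := ?_
    energy_bound := ⟨0, by rw [hI, Measure.restrict_empty]; exact ae_zero.symm ▸ eventually_bot⟩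
    memLp := fun t ht => absurd ht (hIcc t)
    weakGrad_energy := ⟨0, ?_, ?_, fun t ht => absurd ht (hIcc t), ?_⟩
    weak_continuous := fun w _ => ⟨?_, ?_⟩
    strong_initial := ?_ }
  · refine ⟨?_, ?_, ?_, ?_⟩
    · rw [hI, Set.empty_prod, Measure.restrict_empty]; exact aestronglyMeasurable_zero_measure _
    · intro K _; rw [hI, Set.empty_prod, Measure.restrict_empty, lintegral_zero_measure]
      exact ENNReal.zero_lt_top
    · rw [hI, Measure.restrict_empty]; exact ae_zero.symm ▸ eventually_bot
    · intro ψ _ _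
      rw [hI, Measure.restrict_empty, integral_zero_measure, preJunk_zero]
      simp
  · rw [hI, Measure.restrict_empty]; exact ae_zero.symm ▸ eventually_bot
  · rw [hI, Measure.restrict_empty, lintegral_zero_measure]; exact ENNReal.zero_lt_top
  · rw [hI, Measure.restrict_empty]; exact ae_zero.symm ▸ eventually_bot
  · rw [Set.Ioc_eq_empty (by norm_num)]; exact continuousOn_empty _
  · refine tendsto_const_nhds.congr' ?_
    filter_upwards [hev0] with t ht
    rw [ht]
  · refine tendsto_const_nhds.congr' ?_
    filter_upwards [hev0] with t ht
    rw [ht, sub_self]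
    simp

/-- The junk saturates the Type-I(1) rate before `T = −1`: `√(−1−t)‖u(t,x)‖ = 1`. -/
theorem rateNear_preJunk : RateNear 1 1 (-1) preJunk := by
  filter_upwards [self_mem_nhdsWithin] with t ht x
  have ht' : t < -1 := ht
  have hs : 0 < Real.sqrt (-1 - t) := Real.sqrt_pos.2 (by linarith)
  rw [preJunk_of_lt ht']
  simp only [norm_smul, norm_e₁, mul_one, Real.sqrt_one]
  rw [junkAmp, norm_inv, Real.norm_of_nonneg (Real.sqrt_nonneg _), mul_inv_cancel₀ hs.ne']

/-- Scaled local energy of the junk in closed form: `r⁻¹∫_{B_r(x₀)}|u(t)|² = |B₁| r² (−1−t)⁻¹`. -/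
theorem scaledEnergy_preJunk_eq {t : ℝ} (ht : t < -1) (x₀ : E3) {r : ℝ} (hr : 0 < r) :
    r⁻¹ * (∫ x in Metric.ball x₀ r, ‖preJunk t x‖ ^ 2) = unitBallVol * r ^ 2 * (-1 - t)⁻¹ := by
  rw [preJunk_of_lt ht]
  simp only [norm_smul, norm_e₁, mul_one, Real.norm_of_nonneg (junkAmp_pos ht).le]
  rw [setIntegral_const, volume_real_ball_eq x₀ hr.le, smul_eq_mul, junkAmp_sq ht]
  calc r⁻¹ * (r ^ 3 * unitBallVol * (-1 - t)⁻¹)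
        = (r⁻¹ * r) * r ^ 2 * unitBallVol * (-1 - t)⁻¹ := by ring
    _ = unitBallVol * r ^ 2 * (-1 - t)⁻¹ := by rw [inv_mul_cancel₀ hr.ne']; ring

theorem tendsto_inv_sub_nhdsLT : Tendsto (fun t : ℝ => (-1 - t)⁻¹) (𝓝[<] (-1)) atTop := by
  have h1 : Tendsto (fun t : ℝ => -1 - t) (𝓝[<] (-1 : ℝ)) (𝓝[>] 0) := by
    refine tendsto_nhdsWithin_iff.2 ⟨?_, ?_⟩
    · have h : Tendsto (fun t : ℝ => -1 - t) (𝓝 (-1 : ℝ)) (𝓝 (-1 - -1)) :=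
        tendsto_const_nhds.sub tendsto_id
      rw [sub_self] at h
      exact h.mono_left nhdsWithin_le_nhds
    · filter_upwards [self_mem_nhdsWithin] with t ht
      exact mem_Ioi.2 (by simpa using ht)
  exact tendsto_inv_nhdsGT_zero.comp h1

/-- **`0 < T` is load-bearing for 2884.** Without it the statement is FALSE (level `C = 1`,
`ν = 1`, `T = −1`, the pre-initial junk field, radius `r = r₀`, centre `0`). -/
theorem scaledEnergyBound_false_without_posT : ¬ ScaledEnergyBoundWithoutPosT := by
  intro h
  obtain ⟨A, h⟩ := h 1 one_pos
  obtain ⟨r₀, hr₀, hev⟩ := h 1 (-1) one_pos preJunk (fun _ _ => 0)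
    (isClassicalNSSolutionOn_of_nonpos (by norm_num) 1 _ _) (isLerayHopfOn_preJunk 1)
    (by rw [preJunk_zero]; exact hasRapidSpatialDecay_zero) rateNear_preJunk
  have hsq : Tendsto (fun t => unitBallVol * r₀ ^ 2 * (-1 - t)⁻¹) (𝓝[<] (-1)) atTop :=
    tendsto_inv_sub_nhdsLT.const_mul_atTop (by have := unitBallVol_pos; positivity)
  obtain ⟨t, ⟨hle, hgt⟩, ht⟩ :=
    ((hev.and (hsq.eventually_gt_atTop (A * 1 ^ 2))).and self_mem_nhdsWithin).exists
  have h1 := hle 0 r₀ hr₀ le_rfl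
  rw [scaledEnergy_preJunk_eq ht 0 hr₀] at h1
  exact absurd h1 (not_le.2 hgt)

/-! ## §2 `0 < ν` is decoration for 2884 -/

/-- For `ν ≤ 0` the rate hypothesis forces `u ≡ 0` near `T` (`√ν = 0`), so the conclusion holds
with any `A ≥ 0` and any radius: the side condition `0 < ν` carries no information. -/
theorem scaledEnergy_trivial_of_nonpos_viscosity {C ν T A : ℝ} (hν : ν ≤ 0) (hA : 0 ≤ A)
    {u : ℝ → E3 → E3} (hrate : RateNear C ν T u) :
    ∃ r₀ : ℝ, 0 < r₀ ∧ ∀ᶠ t in 𝓝[<] T, ∀ x₀ : E3, ∀ r : ℝ, 0 < r → r ≤ r₀ →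
      r⁻¹ * (∫ x in Metric.ball x₀ r, ‖u t x‖ ^ 2) ≤ A * ν ^ 2 := by
  refine ⟨1, one_pos, ?_⟩
  filter_upwards [hrate, self_mem_nhdsWithin] with t ht htT x₀ r hr _
  have hu : ∀ x, u t x = 0 := fun x => by
    have h := ht x
    rw [Real.sqrt_eq_zero'.2 hν, mul_zero] at h
    have hpos : 0 < Real.sqrt (T - t) := Real.sqrt_pos.2 (sub_pos.2 htT)
    have : ‖u t x‖ ≤ 0 := by
      by_contra hc
      exact absurd h (not_le.2 (mul_pos hpos (not_le.1 hc)))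
    exact norm_le_zero_iff.1 this
  simp only [hu, norm_zero, ne_eq, OfNat.ofNat_ne_zero, not_false_eq_true, zero_pow,
    integral_zero, mul_zero]
  positivity

end Summit.NavierStokesRegularity.NavierStokesRegularity.Cruxes.TypeIConcentration.Drefute

end
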